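import Summits.FinalStateConjecture.FinalStateConjecture.Theorems.BartnikGapSettlingBondiBartnikRigidityStationaryKerrCollarRouteOriented
import Summits.FinalStateConjecture.FinalStateConjecture.Theorems.BartnikGapSettlingBondiBartnikRigiditySlabCauchyRigidityDefs
import HarnessLib

/-!
# K2a `stub_outerBoundaryCollarChart` — CORRECTED statement (diamond-normalised Killing field) and the
# corrected K2 glue — line `direct-method-on-the-cone` (crux `BondiBartnikRigidity`,
# stmt-FinalStateConjecture-10807), wave-2 worker K2a of lead c3

**Audit verdict (worker K2a, 2026-08-17): the registered `K2Route.OuterBoundaryCollarChartOriented` is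
FALSE in the intended model.**  Witness (report `work/stubs/K2a/REPORT.md`, §A3 (w0)): the maximal
vacuum development of the Schwarzschild star slice `{t* = 0, r > 0}` (`M > 1`, `a = 0`), the identity
collar `Φ₀`, and the Killing field `ξ := −∂_{t*}`.  Every hypothesis holds — the block is invariant
under `ξ ↦ −ξ` because the `ξ`-normalising EXACT SHELL BOX
`∃ τ₁ r₁ r₂ Ψ, IsNearModelBox … Ψ ∧ ξ ∘ Ψ = dΨ(Λe₀)` carries NO orientation and NO location: the
static reflection `t ↦ −t` followed by a late `t*`-translation is an exact box chart inside
`(killingDomain)°` pushing `e₀` to `−∂_{t*}` —, while the conclusion's clause `ξ ∘ Ψ = dΨ(Λe₀)` on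
`pullK (O ∩ J⁺_K(slab)°)` (nonempty for `ρ ≥ 3M`, reaching down to the open slab where `Ψ = Φ₀`)
integrates to `Ψ(x₀ + τe₀) = Fl^{−∂_{t*}}_τ(x₀)`, i.e. `t* ∘ Ψ < 0`, contradicting
`Ψ(pullK E) ⊆ (killingDomain)° ⊆ J⁺(C) ⊆ {t* ≥ 0}`.

**The cure** is the hypothesis the line's K1a (`stub_exactMinimiserKilling`) actually delivers and the
paper proof of K2a actually uses: `ξ = dΨ_Δ(Λe₀)` on the CORRECTED DIAMOND `Δ' = slabDiamond'` for an
exact chart `Ψ_Δ` agreeing with `Φ₀` on the whole slab and continuous up to it (F1'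
`F1Route.SlabCauchyRigidity'`, landed) — this pins `ξ` to `+∂_{t*}` on the diamond (the reflected branch
would map the diamond into `I⁻(slab)`, excluded by `image ⊆ J⁺(C)`), and it is where the open–closed
continuation along the roof starts.  An oriented but freely LOCATED box would still leave
`ξ|_{Δ'} = α∂_{t*} + β∂_φ` unpinned in a non-Kerr development.

This file (worker K2a of lead c3; the corrected stub `stub_outerBoundaryCollarChart' :
K2Route.OuterBoundaryCollarChartOriented'` is REGISTERED on the crux item, skeleton rev 6,
`Cruxes/BondiBartnikRigidity/Lines/direct_method_on_the_cone.lean`) records, kernel-checked: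
* `K2Route.OuterBoundaryCollarChartOriented'` — K2a with the box hypothesis replaced by the diamond form
  (conclusion unchanged; note that its `ξ`-clause is not consumed by the glue and may be dropped);
* `K2Route.K2Oriented'` — K2 with the same replacement, and the glue
  `K2Oriented'_of_routeCollar : OuterBoundaryCollarChartOriented' → RoofDevelopmentExtensionCollar →
  KerrLateBoxPlacement → K2Oriented'` (the landed plumbing, verbatim);
* `exactMinimiserKerrnessOriented_plumbing` — how the skeleton's K1a output (diamond form, from F1')
  feeds `K2Oriented'` directly (the intermediate oriented K1 in box form becomes unnecessary).

Route-posited statements are tagged `[conjecture]`; nothing is asserted about them.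
References: Hawking–Ellis 1973, §6.5 [HawkingEllis1973CUP]; Dafermos–Rodnianski 0811.0354 §5.1
[DafermosRodnianski2008]; O'Neill 1983, Ch. 9 (Killing fields) [ONeill1983].
-/

noncomputable section

-- D-0017: single-problem summit, `Summit.<S>.<S>.…` by design (cf. lakefile `weak.linter.dupNamespace`).
set_option linter.dupNamespace false
-- instance search through the nested operator types of the Kerr chart facts
set_option maxSynthPendingDepth 3

open Set Filter Function Topology TopologicalSpace
open Literature.Geometry.Lorentzian
open scoped Manifold ContDiff Topology ENNReal

namespace Summit.FinalStateConjecture.FinalStateConjecture.Theorems.BondiBartnikRigidity.DirectMethod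

namespace K2Route

open F1Route

/-! ### The corrected K2a -/

/-- **K2a corrected — `OuterBoundaryCollarChartOriented'`**: verbatim the landed
`OuterBoundaryCollarChartOriented` except that the `ξ`-normalising hypothesis "exact shell box `Ψ` with
`ξ ∘ Ψ = dΨ(Λe₀)`" (orientation- and location-free, whence the `ξ ↦ −ξ` counterexample) is replaced by
the DIAMOND FORM delivered by F1' + K1a: an exact chart `Ψ` on the corrected diamond
`Δ' = {0 < t*, 3t* + 2r < 6M}`, equal to `Φ₀` on the slab, continuous on `Δ' ∪ slab°`, an open
embedding into `(killingDomain)°` with deviation `0`, on which `ξ = dΨ(Λe₀)`.  Conclusion unchanged: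
for every `ρ` a boundary-collar chart into `(killingDomain)°` with `ξ = dΨ(Λe₀)` over the roof part.
OPEN on paper (route: Müller zum Hagen analyticity, developing-map continuation on the `ξ`-timelike
component, roof stationarity `r ≥ 3M > r_E` along the roof, reach from `HasCutBondiMass`).
Route-posited statement; nothing is asserted. [conjecture] [folklore] -/
def OuterBoundaryCollarChartOriented' : Prop :=
  ∀ [Kerr.Facts] (k' : ℕ), 2 ≤ k' →
    ∀ (X : Type) [TopologicalSpace X] [ChartedSpace E3 X] [IsManifold (𝓡 3) ∞ X]
      [T2Space X] [SecondCountableTopology X] [ConnectedSpace X]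
      (D : InitialDataSet (𝓡 3) X) (𝒱 : VacuumCauchyDevelopment D)
      (M a : Fin 1 → ℝ) (p : 𝒱.carrier) (mo : Fin 1 → lorentzGroup × E4)
      (B : Fin 1 → ModelBackground) (Φ : ∀ i, (B i).domain → 𝒱.carrier)
      (hmax : 𝒱.IsMaximal) (hpar : ∀ i, 0 < M i ∧ |a i| < M i),
    (∃ i, p ∈ Φ i '' (B i).truncTimeSlab (3 * M i) 0) →
    (∀ i, B i = starBackground (mo i).1 (mo i).2 (M i) (a i)
      (fun x => Kerr.radius (a i) (poincareInv (mo i).1 (mo i).2 x))) →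
    (∀ i, ContMDiffOn 𝓘(ℝ, E4) (𝓡 4) ∞ (Φ i)
        {x | -1 < (B i).time x.1 ∧ (B i).time x.1 < 1 ∧ (B i).radius x.1 < 3 * M i + 1} ∧
      IsOpenEmbedding ({x | -1 < (B i).time x.1 ∧ (B i).time x.1 < 1 ∧
        (B i).radius x.1 < 3 * M i + 1}.restrict (Φ i))) →
    (∀ i, 𝒱.toSpacetime.truncDeviationCk (B i) (Φ i) k' (3 * M i) 0 ≤ 0) →
    CollarFutureOriented 𝒱 M mo B Φ →
    collarCore M p B Φ ⊆ range 𝒱.embed →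
    (∃ m : ℝ, 𝒱.toCauchyDevelopment.HasCutBondiMass (collarCore M p B Φ) m) →
    ∀ [𝒱.metric.toPseudoRiemannianMetric.HasLeviCivita],
    ∀ (ξ : Π x : 𝒱.carrier, TangentSpace (𝓡 4) x),
    𝒱.metric.IsKillingFieldOn ξ (interior (killingDomain 𝒱 M p B Φ)) →
    (∃ Ψ : (B 0).domain → 𝒱.carrier,
        (∀ x ∈ (B 0).truncTimeSlab (3 * M 0) 0, Ψ x = Φ 0 x) ∧
        ContinuousOn Ψ (slabDiamondWithSlab' (B 0) (M 0)) ∧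
        ContMDiffOn 𝓘(ℝ, E4) (𝓡 4) ∞ Ψ (slabDiamond' (B 0) (M 0)) ∧
        IsOpenEmbedding ((slabDiamond' (B 0) (M 0)).restrict Ψ) ∧
        Ψ '' slabDiamond' (B 0) (M 0) ⊆ interior (killingDomain 𝒱 M p B Φ) ∧
        supCkENorm (Subtype.val '' slabDiamond' (B 0) (M 0)) 0
          (𝒱.toSpacetime.deviationExtend (B 0) Ψ) ≤ 0 ∧
        ∀ x ∈ slabDiamond' (B 0) (M 0),
          ξ (Ψ x) = mfderiv 𝓘(ℝ, E4) (𝓡 4) Ψ x (((mo 0).1 : E4 ≃L[ℝ] E4) (E4.basisVector 0))) →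
    ∀ ρ : ℝ, ∃ (O : Set (Kerr.region (a 0) (M 0))) (Ψ : (B 0).domain → 𝒱.carrier),
      IsBoundaryCollarChart (mo 0) (M 0) (a 0) (hpar 0).1 (B 0) (collarCore M p B Φ)
        (interior (killingDomain 𝒱 M p B Φ)) (Φ 0) ρ O Ψ ∧
      ∀ x ∈ pullK (mo 0) (M 0) (a 0) (B 0) (O ∩ interior (JK (M 0) (a 0) (hpar 0).1 (slabK (M 0) (a 0)))),
        ξ (Ψ x) = mfderiv 𝓘(ℝ, E4) (𝓡 4) Ψ x (((mo 0).1 : E4 ≃L[ℝ] E4) (E4.basisVector 0))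

/-! ### The corrected K2 and its glue -/

/-- **K2 corrected accordingly — `K2Oriented'`**: the landed `K2Oriented` with the same replacement of
the `ξ`-normalising shell box by the diamond form (what K1a delivers).  The conclusion (exact late
Kerr-star boxes of every size in `J⁺(C)`) mentions no `ξ`, so `K2Oriented` itself is not refuted by
`ξ ↦ −ξ`; the replacement is what makes it PROVABLE along the route (the paper proof needs `ξ` pinned on
the diamond, where the continuation starts).  Route-posited statement; nothing is asserted.
[conjecture] [folklore] -/
def K2Oriented' : Prop :=
  ∀ (k' : ℕ), 2 ≤ k' →
    ∀ (X : Type) [TopologicalSpace X] [ChartedSpace E3 X] [IsManifold (𝓡 3) ∞ X]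
      [T2Space X] [SecondCountableTopology X] [ConnectedSpace X]
      (D : InitialDataSet (𝓡 3) X) (𝒱 : VacuumCauchyDevelopment D)
      (M a : Fin 1 → ℝ) (p : 𝒱.carrier) (mo : Fin 1 → lorentzGroup × E4)
      (B : Fin 1 → ModelBackground) (Φ : ∀ i, (B i).domain → 𝒱.carrier),
    𝒱.IsMaximal → (∀ i, 0 < M i ∧ |a i| < M i) →
    (∃ i, p ∈ Φ i '' (B i).truncTimeSlab (3 * M i) 0) →
    (∀ i, B i = starBackground (mo i).1 (mo i).2 (M i) (a i)
      (fun x => Kerr.radius (a i) (poincareInv (mo i).1 (mo i).2 x))) →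
    (∀ i, ContMDiffOn 𝓘(ℝ, E4) (𝓡 4) ∞ (Φ i)
        {x | -1 < (B i).time x.1 ∧ (B i).time x.1 < 1 ∧ (B i).radius x.1 < 3 * M i + 1} ∧
      IsOpenEmbedding ({x | -1 < (B i).time x.1 ∧ (B i).time x.1 < 1 ∧
        (B i).radius x.1 < 3 * M i + 1}.restrict (Φ i))) →
    (∀ i, 𝒱.toSpacetime.truncDeviationCk (B i) (Φ i) k' (3 * M i) 0 ≤ 0) →
    CollarFutureOriented 𝒱 M mo B Φ →
    collarCore M p B Φ ⊆ range 𝒱.embed →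
    (∃ m : ℝ, 𝒱.toCauchyDevelopment.HasCutBondiMass (collarCore M p B Φ) m) →
    ∀ [𝒱.metric.toPseudoRiemannianMetric.HasLeviCivita],
    ∀ (ξ : Π x : 𝒱.carrier, TangentSpace (𝓡 4) x),
    𝒱.metric.IsKillingFieldOn ξ (interior (killingDomain 𝒱 M p B Φ)) →
    (∃ Ψ : (B 0).domain → 𝒱.carrier,
        (∀ x ∈ (B 0).truncTimeSlab (3 * M 0) 0, Ψ x = Φ 0 x) ∧
        ContinuousOn Ψ (slabDiamondWithSlab' (B 0) (M 0)) ∧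
        ContMDiffOn 𝓘(ℝ, E4) (𝓡 4) ∞ Ψ (slabDiamond' (B 0) (M 0)) ∧
        IsOpenEmbedding ((slabDiamond' (B 0) (M 0)).restrict Ψ) ∧
        Ψ '' slabDiamond' (B 0) (M 0) ⊆ interior (killingDomain 𝒱 M p B Φ) ∧
        supCkENorm (Subtype.val '' slabDiamond' (B 0) (M 0)) 0
          (𝒱.toSpacetime.deviationExtend (B 0) Ψ) ≤ 0 ∧
        ∀ x ∈ slabDiamond' (B 0) (M 0),
          ξ (Ψ x) = mfderiv 𝓘(ℝ, E4) (𝓡 4) Ψ x (((mo 0).1 : E4 ≃L[ℝ] E4) (E4.basisVector 0))) →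
    ∀ (k : ℕ) (R T : ℝ), ∃ (τ : ℝ) (Ψ : (B 0).domain → 𝒱.carrier),
      IsNearModelBox 𝒱.toSpacetime (B 0) k 0 τ (τ + T) (M 0) (R + 1)
        (𝒱.metric.causalFuture 𝒱.timeOrientation (collarCore M p B Φ)) Ψ

/-- **The corrected K2 follows from the corrected K2a, the corrected F5 (marching form) and the landed
F6** — the landed plumbing `K2Oriented_of_routeCollar` verbatim with the diamond-form hypothesis passed
through (the boundary-collar chart's image is moved from `(killingDomain)°` into `J⁺(C)` by
`killingDomain ⊆ J⁺(C)`; the `ξ`-clause of K2a's conclusion is discarded). [folklore] -/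
theorem K2Oriented'_of_routeCollar (h4 : OuterBoundaryCollarChartOriented')
    (h5 : RoofDevelopmentExtensionCollar) (h6 : KerrLateBoxPlacement) : K2Oriented' := by
  haveI : Kerr.Facts :=
    ⟨Kerr.isConnected_region_holds, Kerr.contMDiff_bilin_holds, Kerr.contMDiff_timeVector_holds⟩
  intro k' hk' X _ _ _ _ _ _ D 𝒱 M a p mo B Φ hmax hpar hp hB hΦ hdev hor hCX hcut _ ξ hξ hdia k R T
  have hroof := h4 k' hk' X D 𝒱 M a p mo B Φ hmax hpar hp hB hΦ hdev hor hCX hcut ξ hξ hdia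
  have hroof' : ∀ ρ : ℝ, ∃ (O : Set (Kerr.region (a 0) (M 0))) (Ψ : (B 0).domain → 𝒱.carrier),
      IsBoundaryCollarChart (mo 0) (M 0) (a 0) (hpar 0).1 (B 0) (collarCore M p B Φ)
        (𝒱.metric.causalFuture 𝒱.timeOrientation (collarCore M p B Φ)) (Φ 0) ρ O Ψ := by
    intro ρ
    obtain ⟨O, Ψ, ⟨hO, hsub, hs, he, hJ, hd, hc, hfr, hS⟩, -⟩ := hroof ρ
    exact ⟨O, Ψ, hO, hsub, hs, he,
      hJ.trans (interior_subset.trans (killingDomain_subset_causalFuture 𝒱 M p B Φ)), hd, hc, hfr, hS⟩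
  have hext := h5 k' (le_trans one_le_two hk') X D 𝒱 M a p mo B Φ hmax hpar hp hB hΦ hdev hor hCX hroof'
  obtain ⟨τ, ρ, T₀, hplace⟩ := h6 (M 0) (a 0) R T (hpar 0).1 (hpar 0).2
  obtain ⟨Ψ, hs, he, hJ, hd⟩ := hext ρ T₀
  refine ⟨τ, Ψ, ?_⟩
  have hsub : coordBox (B 0) τ (τ + T) (M 0) (R + 1) ⊆
      pullK (mo 0) (M 0) (a 0) (B 0) (truncFutureK (M 0) (a 0) (hpar 0).1 ρ T₀) :=
    (coordBox_subset_pullK_boxK (hB 0) τ (τ + T) (M 0) (R + 1)).trans (pullK_mono _ _ _ _ hplace)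
  have hopen : IsOpen (coordBox (B 0) τ (τ + T) (M 0) (R + 1)) := by
    rw [hB 0]
    exact isOpen_coordBox (continuous_time_starBackground _ _ _ _ _)
      (continuous_radius_starBackground _ _ _ _) _ _ _ _
  exact isNearModelBox_of_exactOn hs he hJ hd hsub hopen
    (isOpen_image_val_coordBox_of_eq_starBackground (hB 0) _ _ _ _) k

end K2Route

/-! ### How the reshaped skeleton consumes K1a directly -/

/-- **Plumbing for the reshaped skeleton**: F1' (`F1Route.SlabCauchyRigidity'`, landed conditionally on
`choquetBruhat_geroch_exists_mghd_cauchy`) supplies the diamond chart `Ψ` with its continuity clause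
(which the skeleton rev 5 discards — keep it), K1a supplies `ξ` Killing on `(killingDomain)°` with
`ξ = dΨ(Λe₀)` on `Δ'`; together they are EXACTLY the `ξ`-hypothesis of `K2Route.K2Oriented'`, so the
oriented exact-minimiser Kerrness follows from K1a and the corrected K2 without the intermediate box-form
K1.  Stated over an abstract K1a-conclusion `hK1a` to stay independent of the skeleton's stub names.
[folklore] -/
theorem exactMinimiserKerrnessOriented_plumbing (hF1 : F1Route.SlabCauchyRigidity')
    (hK2 : K2Route.K2Oriented')
    (k' : ℕ) (hk' : 2 ≤ k') (X : Type) [TopologicalSpace X] [ChartedSpace E3 X] [IsManifold (𝓡 3) ∞ X]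
    [T2Space X] [SecondCountableTopology X] [ConnectedSpace X]
    (D : InitialDataSet (𝓡 3) X) (𝒱 : VacuumCauchyDevelopment D)
    (M a : Fin 1 → ℝ) (p : 𝒱.carrier) (mo : Fin 1 → lorentzGroup × E4)
    (B : Fin 1 → ModelBackground) (Φ : ∀ i, (B i).domain → 𝒱.carrier)
    (hmax : 𝒱.IsMaximal) (hpar : ∀ i, 0 < M i ∧ |a i| < M i)
    (hp : ∃ i, p ∈ Φ i '' (B i).truncTimeSlab (3 * M i) 0)
    (hB : ∀ i, B i = starBackground (mo i).1 (mo i).2 (M i) (a i)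
      (fun x => Kerr.radius (a i) (poincareInv (mo i).1 (mo i).2 x)))
    (hΦ : ∀ i, ContMDiffOn 𝓘(ℝ, E4) (𝓡 4) ∞ (Φ i)
        {x | -1 < (B i).time x.1 ∧ (B i).time x.1 < 1 ∧ (B i).radius x.1 < 3 * M i + 1} ∧
      IsOpenEmbedding ({x | -1 < (B i).time x.1 ∧ (B i).time x.1 < 1 ∧
        (B i).radius x.1 < 3 * M i + 1}.restrict (Φ i)))
    (hdev : ∀ i, 𝒱.toSpacetime.truncDeviationCk (B i) (Φ i) k' (3 * M i) 0 ≤ 0)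
    (hor : K2Route.CollarFutureOriented 𝒱 M mo B Φ) (htime : K2Route.CollarTimeOriented 𝒱 M a mo B Φ)
    (hCX : collarCore M p B Φ ⊆ range 𝒱.embed)
    (hcut : ∃ m : ℝ, 𝒱.toCauchyDevelopment.HasCutBondiMass (collarCore M p B Φ) m)
    [𝒱.metric.toPseudoRiemannianMetric.HasLeviCivita]
    (hK1a : ∀ Ψ : (B 0).domain → 𝒱.carrier,
      (∀ x ∈ (B 0).truncTimeSlab (3 * M 0) 0, Ψ x = Φ 0 x) →
      ContMDiffOn 𝓘(ℝ, E4) (𝓡 4) ∞ Ψ (F1Route.slabDiamond' (B 0) (M 0)) →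
      IsOpenEmbedding ((F1Route.slabDiamond' (B 0) (M 0)).restrict Ψ) →
      Ψ '' F1Route.slabDiamond' (B 0) (M 0) ⊆ interior (killingDomain 𝒱 M p B Φ) →
      supCkENorm (Subtype.val '' F1Route.slabDiamond' (B 0) (M 0)) 0
        (𝒱.toSpacetime.deviationExtend (B 0) Ψ) ≤ 0 →
      ∃ ξ : Π x : 𝒱.carrier, TangentSpace (𝓡 4) x,
        𝒱.metric.IsKillingFieldOn ξ (interior (killingDomain 𝒱 M p B Φ)) ∧
        ∀ x ∈ F1Route.slabDiamond' (B 0) (M 0),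
          ξ (Ψ x) = mfderiv 𝓘(ℝ, E4) (𝓡 4) Ψ x (((mo 0).1 : E4 ≃L[ℝ] E4) (E4.basisVector 0)))
    (k : ℕ) (R T : ℝ) :
    ∃ (τ : ℝ) (Ψ : (B 0).domain → 𝒱.carrier),
      IsNearModelBox 𝒱.toSpacetime (B 0) k 0 τ (τ + T) (M 0) (R + 1)
        (𝒱.metric.causalFuture 𝒱.timeOrientation (collarCore M p B Φ)) Ψ := by
  obtain ⟨Ψ, hΨΦ, hc, hs, he, hJ, hd⟩ := hF1 k' (le_trans one_le_two hk') X D 𝒱 M a p mo B Φ hmax hpar hp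
    hB hΦ hdev hCX htime
  obtain ⟨ξ, hξ, hξΨ⟩ := hK1a Ψ hΨΦ hs he hJ hd
  exact hK2 k' hk' X D 𝒱 M a p mo B Φ hmax hpar hp hB hΦ hdev hor hCX hcut ξ hξ
    ⟨Ψ, hΨΦ, hc, hs, he, hJ, hd, hξΨ⟩ k R T

/-- **Registered bookkeeping sub-goal of the line** (`stub_k2OrientedOfRouteCollar'`): closed form of the
corrected boundary-collar glue of the corrected K2 — the anchor under which this statement file (corrected K2a',
corrected K2', glue, plumbing) serves the crux item. [conjecture] [folklore] -/
theorem stub_k2OrientedOfRouteCollar' : K2Route.OuterBoundaryCollarChartOriented' → K2Route.RoofDevelopmentExtensionCollar → K2Route.KerrLateBoxPlacement → K2Route.K2Oriented' :=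
  fun h4 h5 h6 ↦ K2Route.K2Oriented'_of_routeCollar h4 h5 h6

end Summit.FinalStateConjecture.FinalStateConjecture.Theorems.BondiBartnikRigidity.DirectMethod

end
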